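import Summits.ValiantsHypothesis.ValiantsHypothesis.Theorems.LacunarySymmetroidMatrixDescartesCensusTropicalKLaw

/-!
# Route «KPlusLogSqLaw», crux `WeakLifting` (stmt-ValiantsHypothesis-19561), docket D2 — FRESH INCIDENCES: a chain of terms has at most
# `(#incidences it uses) − m` steps that bring a never-used incidence; every other step is a columnwise recombination of earlier terms

HONEST FRAMING.  Helper file (cell `pub-symmetroid`, seat val-sym-lift-p3 g25, 2026-08-29) `--supports` the crux
`Summit.ValiantsHypothesis.ValiantsHypothesis.Theses.KPlusLogSqLaw.WeakLifting` (ledger item `stmt-ValiantsHypothesis-19561`, route `KPlusLogSqLaw`;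
docket D2 = the `K = 4` tropical exponent fork).  Pure bookkeeping over an ARBITRARY sequence of terms `p₀, …, pₙ` of format `(m, K)` (no dominance,
no design): it NAMES the decomposition behind the located «fresh-incidence census» of this seat (memo
HOME/val-sym-lift-p3/g25/memo/GRADED-PAGES-AND-SEPARABILITY-liftp3g25.md §3b: along the tree's kernel census chains n ≤ 0.9·(#used incidences) at
`K = 4`, the few non-fresh steps being recombinations of ≥ 3 earlier terms — the latter is the kernel law
`RecombinationReach.not_hybrid_of_two_earlier`).  Nothing here bounds a tropical row or bears on `WeakLifting`, `TropicalB`, `MatrixDescartes`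
(stmt-ValiantsHypothesis-18050) or VP ≠ VNP.

An INCIDENCE of a term `q` is a triple `(q.1 i, i, q.2 i)` (row, column, class).  Step `k → k+1` is FRESH if `p (k+1)` has an incidence used by
none of `p₀, …, p_k`; otherwise `p (k+1)` is, column by column, recombined from the earlier terms (a «zero-fresh» = RECOMBINATION step).
* `card_fresh_le` — `#{fresh steps} + m ≤ #{incidences used by the chain}` (a fresh step owns an incidence first used at `k+1`; `p₀` owns `m`).
* `card_steps_eq` / `le_card_used_add_card_recomb` — `n = #fresh + #recombination steps`, hence
  **`n + m ≤ #{incidences used} + #{recombination steps}`**, and `#{incidences used} ≤ m·m·K`.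
So for every design and chain, `n ≤ m²K − m + Z` with `Z` the number of recombination steps: a law `Z = O(m²)` at `K = 4` would be `TropK4Law 2`.
[folklore counting; the packaging is the cell's]
-/

set_option linter.dupNamespace false
set_option autoImplicit false

namespace Summit.ValiantsHypothesis.ValiantsHypothesis.Theorems.KPlusLogSqLaw

open scoped BigOperators
open Finset

namespace FreshIncidences

variable {m K : ℕ}

/-- **Fresh steps are paid by incidences.**  For any sequence of terms `p₀..pₙ`, the number of steps `k → k+1` at which `p (k+1)` carries an
incidence used by no earlier term, plus `m`, is at most the number of incidences used by the whole sequence. -/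
theorem card_fresh_le {n : ℕ} (p : Fin (n + 1) → Equiv.Perm (Fin m) × (Fin m → Fin K)) :
    (univ.filter fun k : Fin n => ∃ i, ∀ j : Fin (n + 1), j ≤ k.castSucc → ((p k.succ).1 i, i, (p k.succ).2 i) ≠ ((p j).1 i, i, (p j).2 i)).card + m
      ≤ ((univ : Finset (Fin (n + 1) × Fin m)).image fun ki => ((p ki.1).1 ki.2, ki.2, (p ki.1).2 ki.2)).card := by
  classical
  set F := univ.filter fun k : Fin n => ∃ i, ∀ j : Fin (n + 1), j ≤ k.castSucc → ((p k.succ).1 i, i, (p k.succ).2 i) ≠ ((p j).1 i, i, (p j).2 i) with hF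
  set Used := (univ : Finset (Fin (n + 1) × Fin m)).image fun ki => ((p ki.1).1 ki.2, ki.2, (p ki.1).2 ki.2) with hUsed
  -- degenerate size: no column, no fresh step
  rcases isEmpty_or_nonempty (Fin m) with hm | hm
  · have hF0 : F = ∅ := by
      rw [hF]; ext k; simp only [mem_filter, mem_univ, true_and, notMem_empty, iff_false, not_exists]
      intro i; exact (hm.false i).elim
    have hm0 : m = 0 := by
      have h := Fintype.card_eq_zero_iff.mpr hm; rwa [Fintype.card_fin] at h
    rw [hF0, card_empty]; omega
  -- choose for every fresh step a witnessing column
  have hw : ∀ k ∈ F, ∃ i, ∀ j : Fin (n + 1), j ≤ k.castSucc → ((p k.succ).1 i, i, (p k.succ).2 i) ≠ ((p j).1 i, i, (p j).2 i) := fun k hk => (mem_filter.mp hk).2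
  choose! w hw using hw
  -- the owned incidences of fresh steps
  let own : Fin n → Fin m × Fin m × Fin K := fun k => ((p k.succ).1 (w k), (w k), (p k.succ).2 (w k))
  have hinj : Set.InjOn own F := by
    intro k hk k' hk' hkk'
    simp only [own] at hkk'
    by_contra hne
    rcases lt_or_gt_of_ne hne with h | h
    · -- k < k': the incidence of step k' was already used at position k.succ ≤ k'.castSucc
      have hle : k.succ ≤ k'.castSucc := by
        rw [Fin.le_iff_val_le_val, Fin.val_succ, Fin.val_castSucc]; exact h
      have hcol : w k = w k' := by
        have := congrArg (fun t : Fin m × Fin m × Fin K => t.2.1) hkk'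
        simpa using this
      have := hw k' (mem_coe.mp hk') k.succ hle
      rw [hcol] at hkk'
      exact this hkk'.symm
    · have hle : k'.succ ≤ k.castSucc := by
        rw [Fin.le_iff_val_le_val, Fin.val_succ, Fin.val_castSucc]; exact h
      have hcol : w k' = w k := by
        have := congrArg (fun t : Fin m × Fin m × Fin K => t.2.1) hkk'
        simpa using this.symm
      have := hw k (mem_coe.mp hk) k'.succ hle
      rw [hcol] at hkk'
      exact this hkk'
  -- owned incidences are used, and are not incidences of `p 0`
  have hsub : F.image own ⊆ Used \ (univ : Finset (Fin m)).image (fun i => ((p 0).1 i, i, (p 0).2 i)) := by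
    intro t ht
    obtain ⟨k, hk, rfl⟩ := mem_image.mp ht
    rw [mem_sdiff]
    refine ⟨mem_image.mpr ⟨(k.succ, w k), mem_univ _, rfl⟩, ?_⟩
    intro h0
    obtain ⟨i, -, hi⟩ := mem_image.mp h0
    have hcol : i = w k := by
      have := congrArg (fun t : Fin m × Fin m × Fin K => t.2.1) hi
      simpa using this
    subst hcol
    exact hw k hk 0 (Fin.zero_le _) hi.symm
  have h0sub : (univ : Finset (Fin m)).image (fun i => ((p 0).1 i, i, (p 0).2 i)) ⊆ Used := by
    intro t ht
    obtain ⟨i, -, rfl⟩ := mem_image.mp ht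
    exact mem_image.mpr ⟨(0, i), mem_univ _, rfl⟩
  have h0card : ((univ : Finset (Fin m)).image (fun i => ((p 0).1 i, i, (p 0).2 i))).card = m := by
    rw [card_image_of_injective _ (fun i j hij => by
      have := congrArg (fun t : Fin m × Fin m × Fin K => t.2.1) hij; simpa using this)]
    simp
  have h1 : F.card = (F.image own).card := (card_image_of_injOn hinj).symm
  have h2 := card_le_card hsub
  rw [card_sdiff_of_subset h0sub, h0card] at h2
  have h3 := card_le_card h0sub
  omega

/-- Every step is fresh or a recombination step (complementary filters). -/
theorem card_steps_eq {n : ℕ} (p : Fin (n + 1) → Equiv.Perm (Fin m) × (Fin m → Fin K)) :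
    (univ.filter fun k : Fin n => ∃ i, ∀ j : Fin (n + 1), j ≤ k.castSucc → ((p k.succ).1 i, i, (p k.succ).2 i) ≠ ((p j).1 i, i, (p j).2 i)).card
      + (univ.filter fun k : Fin n => ∀ i, ∃ j : Fin (n + 1), j ≤ k.castSucc ∧ ((p k.succ).1 i, i, (p k.succ).2 i) = ((p j).1 i, i, (p j).2 i)).card = n := by
  classical
  have h := Finset.card_filter_add_card_filter_not
    (s := (univ : Finset (Fin n))) (fun k : Fin n => ∃ i, ∀ j : Fin (n + 1), j ≤ k.castSucc →
      ((p k.succ).1 i, i, (p k.succ).2 i) ≠ ((p j).1 i, i, (p j).2 i))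
  rw [card_univ, Fintype.card_fin] at h
  have hB : (univ.filter fun k : Fin n => ¬ ∃ i, ∀ j : Fin (n + 1), j ≤ k.castSucc →
        ((p k.succ).1 i, i, (p k.succ).2 i) ≠ ((p j).1 i, i, (p j).2 i))
      = univ.filter fun k : Fin n => ∀ i, ∃ j : Fin (n + 1), j ≤ k.castSucc ∧
        ((p k.succ).1 i, i, (p k.succ).2 i) = ((p j).1 i, i, (p j).2 i) := by
    ext k
    simp only [mem_filter, mem_univ, true_and, not_exists, not_forall, not_not, exists_prop]
  rw [hB] at h
  exact h

/-- **The fresh-incidence inequality.**  For any sequence of terms `p₀..pₙ` of format `(m, K)`: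
`n + m ≤ #{incidences used} + #{recombination steps}` — with `Z` recombination steps, `n ≤ (#used − m) + Z`. -/
theorem le_card_used_add_card_recomb {n : ℕ} (p : Fin (n + 1) → Equiv.Perm (Fin m) × (Fin m → Fin K)) :
    n + m ≤ ((univ : Finset (Fin (n + 1) × Fin m)).image fun ki => ((p ki.1).1 ki.2, ki.2, (p ki.1).2 ki.2)).card
      + (univ.filter fun k : Fin n => ∀ i, ∃ j : Fin (n + 1), j ≤ k.castSucc ∧ ((p k.succ).1 i, i, (p k.succ).2 i) = ((p j).1 i, i, (p j).2 i)).card := by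
  have h1 := card_fresh_le p
  have h2 := card_steps_eq p
  omega

/-- The incidences used by a sequence of terms number at most `m·m·K`. -/
theorem card_used_le {n : ℕ} (p : Fin (n + 1) → Equiv.Perm (Fin m) × (Fin m → Fin K)) :
    ((univ : Finset (Fin (n + 1) × Fin m)).image fun ki => ((p ki.1).1 ki.2, ki.2, (p ki.1).2 ki.2)).card ≤ m * m * K := by
  classical
  calc ((univ : Finset (Fin (n + 1) × Fin m)).image fun ki => ((p ki.1).1 ki.2, ki.2, (p ki.1).2 ki.2)).card
      ≤ (univ : Finset (Fin m × Fin m × Fin K)).card := card_le_card (subset_univ _)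
    _ = m * m * K := by simp [Fintype.card_prod, Fintype.card_fin, mul_assoc]

/-- **Consequence.**  Every sequence of terms of format `(m, K)` with `Z` recombination steps has `n + m ≤ m·m·K + Z`. -/
theorem le_incidences_add_card_recomb {n : ℕ} (p : Fin (n + 1) → Equiv.Perm (Fin m) × (Fin m → Fin K)) :
    n + m ≤ m * m * K
      + (univ.filter fun k : Fin n => ∀ i, ∃ j : Fin (n + 1), j ≤ k.castSucc ∧ ((p k.succ).1 i, i, (p k.succ).2 i) = ((p j).1 i, i, (p j).2 i)).card := by
  have h1 := le_card_used_add_card_recomb p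
  have h2 := card_used_le p
  omega

end FreshIncidences

end Summit.ValiantsHypothesis.ValiantsHypothesis.Theorems.KPlusLogSqLaw
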